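import Mathlib
import Literature.Geometry.Symplectic.JRotationBranchRegularity
import HarnessLib

/-!
# The rotated branch has bounded derivative (Wendl 2020, App. B, Lemmas B.31/B.35, quantitative)

Continuation of `Literature/Geometry/Symplectic/JRotationBranchSolve.lean` and
`…/JRotationBranchRegularity.lean`. There, for `0 < |s| < ε₁`, Wendl's equation (B.20) for the
rotated branch `θ ≈ ε̄ s` of the `k`-fold normal form `(sᵏ, û s)` was solved by the fixed point
`sol s = (θ(s), η(s))` of the `½`-contraction `T_s` of a box, and `s ↦ sol s` was shown to be `C¹`
on the punctured disc. Here we add the QUANTITATIVE statement the similarity principle needs at the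
puncture: the derivative of `sol` is BOUNDED near `0` (`exists_norm_fderiv_sol_le`).

The argument is the fixed-point one (no second implicit-function computation): since `sol s` lies
in the inner half of the box of every nearby parameter `s'` and `T_{s'}` is a `½`-contraction
there, `‖sol s' - sol s‖ ≤ 2 ‖T_{s'}(sol s) - T_s(sol s)‖` for `s'` near `s`
(`eventually_norm_sol_sub_le`); a derivative is bounded by any such eventual comparison
(`norm_fderiv_le_of_eventually_norm_sub_le`), and `s ↦ T_s v` has derivative bounded by
`1 + L + L k + C_u` (`norm_fderiv_Tmap_left_le`: the root branch `s ↦ ε̄ s ᵏ√(1 - a s⁻ᵏ)` has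
derivative `≤ 1 + L + L k` when `|a| < δ |s|ᵏ`, `norm_fderiv_root_le`, and `‖Dû(s)‖ ≤ C_u |s|ᵏ`).
This replaces, for the purposes of the representation formula (Wendl 2020, Thm B.23, §B.2.5, where
only `dη → 0` is recorded), the cylindrical `C¹`-convergence of Lemma B.35.

Everything is proved; no named facts.

## References

* C. Wendl, *Lectures on Contact 3-Manifolds, Holomorphic Curves and Intersection Theory*,
  Cambridge Tracts in Math. 220 (2020), App. B, Lemmas B.31, B.34, B.35 and §B.2.5. [Wendl2020]
* M. Micallef, B. White, *The structure of branch points in minimal surfaces and in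
  pseudoholomorphic curves*, Ann. of Math. 141 (1995), §6. [MicallefWhite1995]
-/

noncomputable section

open scoped Topology ContDiff NNReal
open Set Filter Metric Function Complex

namespace Literature.Geometry.Symplectic.RotationBranch

open Literature.Analysis.Complex.KthRootChart

/-! ### A1. A derivative is bounded by any eventual comparison of increments -/

/-- **Derivative norms from an eventual comparison of increments.** If `f` and `g` are
differentiable at `x` and `‖f y - f x‖ ≤ C ‖g y - g x‖` for all `y` near `x`, then
`‖Df(x)‖ ≤ C ‖Dg(x)‖`. [folklore] -/
theorem norm_fderiv_le_of_eventually_norm_sub_le {E F G : Type*} [NormedAddCommGroup E]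
    [NormedSpace ℝ E] [NormedAddCommGroup F] [NormedSpace ℝ F] [NormedAddCommGroup G]
    [NormedSpace ℝ G] {f : E → F} {g : E → G} {x : E} {C : ℝ} (hC : 0 ≤ C)
    (hf : DifferentiableAt ℝ f x) (hg : DifferentiableAt ℝ g x)
    (h : ∀ᶠ y in 𝓝 x, ‖f y - f x‖ ≤ C * ‖g y - g x‖) :
    ‖fderiv ℝ f x‖ ≤ C * ‖fderiv ℝ g x‖ := by
  set Df := fderiv ℝ f x with hDf
  set Dg := fderiv ℝ g x with hDg
  -- ### directional estimate along rays
  have hdir : ∀ v : E, ‖Df v‖ ≤ C * ‖Dg v‖ := by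
    intro v
    refine le_of_forall_pos_le_add fun ε hε => ?_
    set ε' : ℝ := ε / ((C + 1) * (‖v‖ + 1)) with hε'
    have hε'pos : 0 < ε' := by positivity
    have h1 : ∀ᶠ y in 𝓝 x, ‖f y - f x - Df (y - x)‖ ≤ ε' * ‖y - x‖ :=
      hf.hasFDerivAt.isLittleO.def hε'pos
    have h2 : ∀ᶠ y in 𝓝 x, ‖g y - g x - Dg (y - x)‖ ≤ ε' * ‖y - x‖ :=
      hg.hasFDerivAt.isLittleO.def hε'pos
    -- the ray `t ↦ x + t • v` tends to `x` as `t → 0⁺`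
    have hray : Tendsto (fun t : ℝ => x + t • v) (𝓝[>] 0) (𝓝 x) := by
      have : Tendsto (fun t : ℝ => x + t • v) (𝓝 0) (𝓝 (x + (0 : ℝ) • v)) :=
        ((continuous_const.add (continuous_id.smul continuous_const)).tendsto 0)
      rw [zero_smul, add_zero] at this
      exact this.mono_left nhdsWithin_le_nhds
    obtain ⟨t, ⟨ht, ht1, ht2⟩, htpos⟩ :=
      ((hray.eventually (h.and (h1.and h2))).and self_mem_nhdsWithin).exists
    have htpos' : (0 : ℝ) < t := htpos
    have hyx : x + t • v - x = t • v := add_sub_cancel_left x (t • v)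
    rw [hyx, map_smul] at ht1 ht2
    have hnorm : ‖t • v‖ = t * ‖v‖ := by rw [norm_smul, Real.norm_of_nonneg htpos'.le]
    rw [hnorm] at ht1 ht2
    -- `t ‖Df v‖ ≤ ‖f y - f x‖ + ε' t ‖v‖`
    have e1 : t * ‖Df v‖ ≤ ‖f (x + t • v) - f x‖ + ε' * (t * ‖v‖) := by
      have h3 : ‖t • Df v‖ = t * ‖Df v‖ := by rw [norm_smul, Real.norm_of_nonneg htpos'.le]
      have h4 : ‖t • Df v‖ ≤ ‖f (x + t • v) - f x‖ + ‖f (x + t • v) - f x - t • Df v‖ :=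
        norm_le_insert _ _
      linarith [h4, ht1]
    -- `‖g y - g x‖ ≤ t ‖Dg v‖ + ε' t ‖v‖`
    have e2 : ‖g (x + t • v) - g x‖ ≤ t * ‖Dg v‖ + ε' * (t * ‖v‖) := by
      have h3 : ‖t • Dg v‖ = t * ‖Dg v‖ := by rw [norm_smul, Real.norm_of_nonneg htpos'.le]
      have h4 : ‖g (x + t • v) - g x‖ ≤ ‖t • Dg v‖ + ‖g (x + t • v) - g x - t • Dg v‖ :=
        norm_le_insert' _ _
      linarith [h4, ht2]
    -- combine and divide by `t`
    have e3 : t * ‖Df v‖ ≤ t * (C * ‖Dg v‖ + ε' * (C + 1) * ‖v‖) := by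
      calc t * ‖Df v‖ ≤ ‖f (x + t • v) - f x‖ + ε' * (t * ‖v‖) := e1
        _ ≤ C * ‖g (x + t • v) - g x‖ + ε' * (t * ‖v‖) := by gcongr
        _ ≤ C * (t * ‖Dg v‖ + ε' * (t * ‖v‖)) + ε' * (t * ‖v‖) := by gcongr
        _ = t * (C * ‖Dg v‖ + ε' * (C + 1) * ‖v‖) := by ring
    have e4 : ‖Df v‖ ≤ C * ‖Dg v‖ + ε' * (C + 1) * ‖v‖ := le_of_mul_le_mul_left e3 htpos'
    have e5 : ε' * (C + 1) * ‖v‖ ≤ ε := by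
      rw [hε']
      have hC1 : 0 < C + 1 := by linarith
      have hv1 : 0 < ‖v‖ + 1 := by positivity
      rw [div_mul_eq_mul_div, div_mul_eq_mul_div, div_le_iff₀ (by positivity)]
      nlinarith [norm_nonneg v, hε.le]
    linarith
  -- ### operator norm
  refine ContinuousLinearMap.opNorm_le_bound _ (by positivity) fun v => ?_
  calc ‖Df v‖ ≤ C * ‖Dg v‖ := hdir v
    _ ≤ C * (‖Dg‖ * ‖v‖) := by gcongr; exact Dg.le_opNorm v
    _ = C * ‖Dg‖ * ‖v‖ := by ring

/-! ### A2. The derivative of the root branch in `s` -/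

/-- **The root branch has bounded `s`-derivative.** With `L, δ` as in
`Literature.Analysis.Complex.KthRootChart.exists_kthRoot_lipschitz` (`ᵏ√` is within `L|w-1|` of
`1` and has derivative `≤ L` on `B(1,δ)`, `δ ≤ 1`): for `s ≠ 0`, `|ε̄| = 1` and `|a| < δ |s|ᵏ`, the
map `s' ↦ root(s', a) = ε̄ s' ᵏ√((s'ᵏ - a)/s'ᵏ)` is differentiable at `s` with
`‖D_s root(s, a)‖ ≤ 1 + L + L k`. [cite: Wendl2020, App. B, proof of Lemma B.34] -/
theorem norm_fderiv_root_le {k : ℕ} (hk : k ≠ 0) {L δ : ℝ} (hL : 0 ≤ L) (hδ1 : δ ≤ 1)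
    (hLip1 : ∀ w ∈ ball (1 : ℂ) δ, ‖kroot k w - 1‖ ≤ L * ‖w - 1‖)
    (hDer : ∀ w ∈ ball (1 : ℂ) δ, ‖fderiv ℝ (kroot k) w‖ ≤ L)
    {εb : ℂ} (hεn : ‖εb‖ = 1) {s a : ℂ} (hs : s ≠ 0) (ha : ‖a‖ < δ * ‖s‖ ^ k) :
    DifferentiableAt ℝ (fun s' : ℂ => root k εb s' a) s ∧
      ‖fderiv ℝ (fun s' : ℂ => root k εb s' a) s‖ ≤ 1 + L + L * k := by
  have hsk : s ^ k ≠ 0 := pow_ne_zero k hs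
  have hnsk : 0 < ‖s‖ ^ k := by positivity
  have hδpos : 0 < δ := by
    by_contra hδ
    push Not at hδ
    have : δ * ‖s‖ ^ k ≤ 0 := mul_nonpos_of_nonpos_of_nonneg hδ hnsk.le
    linarith [norm_nonneg a]
  -- ### the quotient `q(s') = (s'ᵏ - a)/s'ᵏ`
  set q : ℂ → ℂ := fun s' => (s' ^ k - a) / s' ^ k with hq_def
  have hqmem : q s ∈ ball (1 : ℂ) δ := by
    rw [mem_ball, dist_eq_norm, hq_def]
    dsimp only
    rw [sub_div, div_self hsk, sub_sub_cancel_left, norm_neg, norm_div, norm_pow,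
      div_lt_iff₀ hnsk]
    exact ha
  set q' : ℂ := a * (k * s ^ (k - 1)) / (s ^ k) ^ 2 with hq'_def
  have hq : HasDerivAt q q' s := by
    have hnum : HasDerivAt (fun s' : ℂ => s' ^ k - a) (k * s ^ (k - 1)) s :=
      (hasDerivAt_pow k s).sub_const a
    have hden : HasDerivAt (fun s' : ℂ => s' ^ k) (k * s ^ (k - 1)) s := hasDerivAt_pow k s
    have h := hnum.div hden hsk
    have he : ((k : ℂ) * s ^ (k - 1) * s ^ k - (s ^ k - a) * (k * s ^ (k - 1))) / (s ^ k) ^ 2 = q' := by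
      rw [hq'_def]; ring
    rw [he] at h
    exact h
  -- `‖s‖ ‖q'‖ = k ‖a‖ / ‖s‖ᵏ < k δ`
  have hsq' : ‖s‖ * ‖q'‖ ≤ k * δ := by
    have hk1 : s * s ^ (k - 1) = s ^ k := by
      rw [← pow_succ']; congr 1; omega
    have h1 : s * q' = a * k / s ^ k := by
      rw [hq'_def]
      field_simp
      rw [← hk1]; ring
    have h2 : ‖s‖ * ‖q'‖ = ‖a‖ * k / ‖s‖ ^ k := by
      rw [← norm_mul, h1, norm_div, norm_mul, norm_pow, Complex.norm_natCast]
    rw [h2, div_le_iff₀ hnsk]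
    calc ‖a‖ * k ≤ δ * ‖s‖ ^ k * k := by gcongr
      _ = k * δ * ‖s‖ ^ k := by ring
  -- ### the root factor `K = ᵏ√ ∘ q`
  have hKd : DifferentiableAt ℝ (kroot k) (q s) :=
    (contDiffAt_kthRoot k (ball_one_subset_slitPlane_of_le hδ1 hqmem) (n := 1)).differentiableAt
      one_ne_zero
  have hKval : ‖kroot k (q s)‖ ≤ 1 + L := by
    have h1 := hLip1 _ hqmem
    have h2 : ‖q s - 1‖ < δ := by rwa [mem_ball, dist_eq_norm] at hqmem
    have h3 : ‖kroot k (q s)‖ ≤ ‖kroot k (q s) - 1‖ + ‖(1 : ℂ)‖ := norm_le_norm_sub_add _ _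
    rw [norm_one] at h3
    have h4 : L * ‖q s - 1‖ ≤ L * 1 := by gcongr; linarith
    linarith
  set Q : ℂ →L[ℝ] ℂ := (ContinuousLinearMap.smulRight (1 : ℂ →L[ℂ] ℂ) q').restrictScalars ℝ
    with hQ
  have hqF : HasFDerivAt q Q s := hq.hasFDerivAt.restrictScalars ℝ
  have hQn : ‖Q‖ ≤ ‖q'‖ := by
    refine ContinuousLinearMap.opNorm_le_bound _ (norm_nonneg _) fun v => ?_
    rw [hQ, ContinuousLinearMap.coe_restrictScalars', ContinuousLinearMap.smulRight_apply,
      one_apply_eq_self, smul_eq_mul, norm_mul, mul_comm]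
  have hKq : HasFDerivAt (fun s' => kroot k (q s')) ((fderiv ℝ (kroot k) (q s)).comp Q) s :=
    hKd.hasFDerivAt.comp s hqF
  have hKqn : ‖(fderiv ℝ (kroot k) (q s)).comp Q‖ ≤ L * ‖q'‖ :=
    (ContinuousLinearMap.opNorm_comp_le _ _).trans (mul_le_mul (hDer _ hqmem) hQn (norm_nonneg _) hL)
  -- ### the linear factor `s' ↦ ε̄ s'`
  set Mℓ : ℂ →L[ℝ] ℂ := (ContinuousLinearMap.smulRight (1 : ℂ →L[ℂ] ℂ) εb).restrictScalars ℝ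
    with hMℓ
  have hm : HasFDerivAt (fun s' : ℂ => εb * s') Mℓ s := by
    have h1 : HasDerivAt (fun s' : ℂ => εb * s') εb s := by
      simpa using (hasDerivAt_id s).const_mul εb
    exact h1.hasFDerivAt.restrictScalars ℝ
  have hMn : ‖Mℓ‖ ≤ 1 := by
    refine ContinuousLinearMap.opNorm_le_bound _ zero_le_one fun v => ?_
    rw [hMℓ, ContinuousLinearMap.coe_restrictScalars', ContinuousLinearMap.smulRight_apply,
      one_apply_eq_self, smul_eq_mul, norm_mul, hεn, mul_comm]
  -- ### the product
  have hprod : HasFDerivAt (fun s' : ℂ => εb * s' * kroot k (q s'))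
      ((εb * s) • (fderiv ℝ (kroot k) (q s)).comp Q + kroot k (q s) • Mℓ) s := hm.mul hKq
  have hfun : (fun s' : ℂ => root k εb s' a) = fun s' : ℂ => εb * s' * kroot k (q s') := by
    funext s'; rfl
  rw [hfun]
  refine ⟨hprod.differentiableAt, ?_⟩
  rw [hprod.fderiv]
  calc ‖(εb * s) • (fderiv ℝ (kroot k) (q s)).comp Q + kroot k (q s) • Mℓ‖
      ≤ ‖(εb * s) • (fderiv ℝ (kroot k) (q s)).comp Q‖ + ‖kroot k (q s) • Mℓ‖ := norm_add_le _ _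
    _ ≤ ‖s‖ * (L * ‖q'‖) + (1 + L) * 1 := by
        rw [norm_smul, norm_smul, norm_mul, hεn, one_mul]
        gcongr
    _ = L * (‖s‖ * ‖q'‖) + (1 + L) := by ring
    _ ≤ L * (k * δ) + (1 + L) := by gcongr
    _ ≤ L * (k * 1) + (1 + L) := by gcongr
    _ = 1 + L + L * k := by ring

/-! ### A3. The `s`-derivative of `T_s v` -/

variable {k : ℕ} {εb : ℂ} {uh : ℂ → ℂ} {X : ℂ × ℂ → ℂ →L[ℝ] ℂ × ℂ}

/-- **`s ↦ T_s v` has bounded derivative**: `‖D_s T_s v‖ ≤ 1 + L + L k + C_u` when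
`|X̌_{v.2}(p v.1)| < δ |s|ᵏ`, `‖Dû(s)‖ ≤ C_u |s|ᵏ` and `|s| ≤ 1`. [cite: Wendl2020, App. B,
Lemmas B.34–B.35] -/
theorem norm_fderiv_Tmap_left_le (hk : k ≠ 0) {L δ : ℝ} (hL : 0 ≤ L) (hδ1 : δ ≤ 1)
    (hLip1 : ∀ w ∈ ball (1 : ℂ) δ, ‖kroot k w - 1‖ ≤ L * ‖w - 1‖)
    (hDer : ∀ w ∈ ball (1 : ℂ) δ, ‖fderiv ℝ (kroot k) w‖ ≤ L) (hεn : ‖εb‖ = 1)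
    {Cu ρ₁ : ℝ} (hCu : 0 ≤ Cu) (hu1 : ContDiffOn ℝ 1 uh (ball 0 ρ₁))
    (hDu : ∀ w ∈ ball (0 : ℂ) ρ₁, ‖fderiv ℝ uh w‖ ≤ Cu * ‖w‖ ^ k)
    {s : ℂ} {v : ℂ × ℂ} (hs : s ≠ 0) (hs1 : ‖s‖ ≤ 1) (hsρ : s ∈ ball (0 : ℂ) ρ₁)
    (ha : ‖(X (pt k uh v.1) v.2).1‖ < δ * ‖s‖ ^ k) :
    DifferentiableAt ℝ (fun s' : ℂ => Tmap k εb uh X s' v) s ∧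
      ‖fderiv ℝ (fun s' : ℂ => Tmap k εb uh X s' v) s‖ ≤ 1 + L + L * k + Cu := by
  set a : ℂ := (X (pt k uh v.1) v.2).1 with ha_def
  set c : ℂ := uh v.1 + ((X (pt k uh v.1) v.2).2 - v.2) with hc_def
  obtain ⟨hrd, hrn⟩ := norm_fderiv_root_le hk hL hδ1 hLip1 hDer hεn hs ha
  have hud : DifferentiableAt ℝ uh s :=
    (hu1.differentiableOn one_ne_zero).differentiableAt (isOpen_ball.mem_nhds hsρ)
  have h2 : HasFDerivAt (fun s' : ℂ => uh s' - c) (fderiv ℝ uh s) s := hud.hasFDerivAt.sub_const c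
  have hT : HasFDerivAt (fun s' : ℂ => Tmap k εb uh X s' v)
      ((fderiv ℝ (fun s' : ℂ => root k εb s' a) s).prod (fderiv ℝ uh s)) s := by
    have h := hrd.hasFDerivAt.prodMk h2
    refine h.congr_of_eventuallyEq (Eventually.of_forall fun s' => ?_)
    show Tmap k εb uh X s' v = (root k εb s' a, uh s' - c)
    refine Prod.ext rfl ?_
    show uh s' - uh v.1 - ((X (pt k uh v.1) v.2).2 - v.2) = uh s' - c
    rw [hc_def]; ring
  refine ⟨hT.differentiableAt, ?_⟩
  rw [hT.fderiv, ContinuousLinearMap.opNorm_prod]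
  have hu' : ‖fderiv ℝ uh s‖ ≤ Cu := by
    calc ‖fderiv ℝ uh s‖ ≤ Cu * ‖s‖ ^ k := hDu s hsρ
      _ ≤ Cu * 1 := by gcongr; exact pow_le_one₀ (norm_nonneg _) hs1
      _ = Cu := mul_one _
  rw [Prod.norm_def]
  refine max_le ?_ ?_
  · linarith
  · have : 0 ≤ 1 + L + L * k := by positivity
    linarith

/-! ### A4. The bounded derivative of the solution map -/

/-- **Increments of the solution map are controlled by increments of `T` in `s`.** Under the
conclusions of `exists_regular_branch` at an admissible `s` (write `v = sol s`): for `s'` near `s`,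
`‖sol s' - sol s‖ ≤ 2 ‖T_{s'} v - T_s v‖` (`v` lies in the inner half of the box of `s`, hence in
the box of `s'`, on which `T_{s'}` is a `½`-contraction fixing `sol s'`).
[cite: Wendl2020, App. B, Lemma B.35] -/
theorem eventually_norm_sol_sub_le (hεn : ‖εb‖ = 1) {Cu ε₁ : ℝ}
    (hreg : ∀ s : ℂ, s ≠ 0 → ‖s‖ < ε₁ →
      sol k εb uh X (2 * Cu + 1) s ∈ box k εb (2 * Cu + 1) s ∧
      Tmap k εb uh X s (sol k εb uh X (2 * Cu + 1) s) = sol k εb uh X (2 * Cu + 1) s ∧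
      ‖(sol k εb uh X (2 * Cu + 1) s).1 - εb * s‖ ≤ ‖s‖ ^ (k + 2) / 2 ∧
      ‖(sol k εb uh X (2 * Cu + 1) s).2‖ ≤ (2 * Cu + 1 / 2) * ‖s‖ ^ (k + 1) ∧
      (∀ v ∈ box k εb (2 * Cu + 1) s, ∀ v' ∈ box k εb (2 * Cu + 1) s,
        dist (Tmap k εb uh X s v) (Tmap k εb uh X s v') ≤ dist v v' / 2))
    {s : ℂ} (hs : s ≠ 0) (hsε : ‖s‖ < ε₁) :
    ∀ᶠ s' in 𝓝 s, ‖sol k εb uh X (2 * Cu + 1) s' - sol k εb uh X (2 * Cu + 1) s‖ ≤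
      2 * ‖Tmap k εb uh X s' (sol k εb uh X (2 * Cu + 1) s) -
        Tmap k εb uh X s (sol k εb uh X (2 * Cu + 1) s)‖ := by
  set b : ℝ := 2 * Cu + 1 with hb
  obtain ⟨-, hfix, hin1, hin2, -⟩ := hreg s hs hsε
  set v := sol k εb uh X b s with hv
  have hadm : ∀ᶠ s' in 𝓝 s, s' ≠ 0 ∧ ‖s'‖ < ε₁ :=
    (isOpen_ne.inter (isOpen_lt continuous_norm continuous_const)).mem_nhds ⟨hs, hsε⟩
  -- `v` lies in the box of every nearby `s'`
  have hvbox' : ∀ᶠ s' in 𝓝 s, v ∈ box k εb b s' := by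
    have hg₁ : Tendsto (fun s' : ℂ => ‖s'‖ ^ (k + 2) - ‖s' - s‖) (𝓝 s)
        (𝓝 (‖s‖ ^ (k + 2) - ‖s - s‖)) :=
      ((continuous_norm.pow _).sub (continuous_id.sub continuous_const).norm).tendsto s
    have e₁ : ∀ᶠ s' in 𝓝 s, ‖s‖ ^ (k + 2) / 2 < ‖s'‖ ^ (k + 2) - ‖s' - s‖ :=
      hg₁.eventually_const_lt (by simp; positivity)
    have hg₂ : Tendsto (fun s' : ℂ => b * ‖s'‖ ^ (k + 1)) (𝓝 s) (𝓝 (b * ‖s‖ ^ (k + 1))) :=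
      (continuous_const.mul (continuous_norm.pow _)).tendsto s
    have e₂ : ∀ᶠ s' in 𝓝 s, (2 * Cu + 1 / 2) * ‖s‖ ^ (k + 1) < b * ‖s'‖ ^ (k + 1) :=
      hg₂.eventually_const_lt (by
        rw [hb]
        have : (0 : ℝ) < ‖s‖ ^ (k + 1) := by positivity
        nlinarith)
    filter_upwards [e₁, e₂] with s' h₁ h₂
    rw [mem_box]
    constructor
    · have hn : ‖εb * (s - s')‖ = ‖s' - s‖ := by rw [norm_mul, hεn, one_mul, norm_sub_rev]
      calc ‖v.1 - εb * s'‖ = ‖(v.1 - εb * s) + εb * (s - s')‖ := by congr 1; ring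
        _ ≤ ‖v.1 - εb * s‖ + ‖εb * (s - s')‖ := norm_add_le _ _
        _ ≤ ‖s‖ ^ (k + 2) / 2 + ‖s' - s‖ := by rw [hn]; exact add_le_add hin1 le_rfl
        _ ≤ ‖s'‖ ^ (k + 2) := by linarith
    · exact hin2.trans h₂.le
  filter_upwards [hadm, hvbox'] with s' h₁ h₂
  obtain ⟨hbox₁, hfix₁, -, -, hcontr₁⟩ := hreg s' h₁.1 h₁.2
  have hd : dist (sol k εb uh X b s') v ≤ dist (sol k εb uh X b s') v / 2 +
      dist (Tmap k εb uh X s' v) (Tmap k εb uh X s v) := by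
    calc dist (sol k εb uh X b s') v
        = dist (Tmap k εb uh X s' (sol k εb uh X b s')) (Tmap k εb uh X s v) := by rw [hfix₁, hfix]
      _ ≤ dist (Tmap k εb uh X s' (sol k εb uh X b s')) (Tmap k εb uh X s' v) +
          dist (Tmap k εb uh X s' v) (Tmap k εb uh X s v) := dist_triangle _ _ _
      _ ≤ dist (sol k εb uh X b s') v / 2 + dist (Tmap k εb uh X s' v) (Tmap k εb uh X s v) :=
          add_le_add (hcontr₁ _ hbox₁ _ h₂) le_rfl
  rw [← dist_eq_norm, ← dist_eq_norm]
  linarith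

/-- **The rotated branch has bounded derivative** (quantitative complement to Wendl 2020,
Lemma B.35). Under the hypotheses of `exists_regular_branch`: there are `ε₂ > 0` and `B ≥ 0` with
`‖D sol(s)‖ ≤ B` for all `0 < |s| < ε₂`; in particular both components `θ = (sol ·).1` and
`η = (sol ·).2` have derivative bounded by `B` on the punctured disc.
[cite: Wendl2020, App. B, Lemmas B.31 and B.35, §B.2.5] -/
theorem exists_norm_fderiv_sol_le (hk : k ≠ 0) (hε : εb ^ k = 1) (hεn : ‖εb‖ = 1)
    {Cu ρ₁ CX δX : ℝ} (hCu : 0 ≤ Cu) (hCX : 0 ≤ CX) (hρ₁ : 0 < ρ₁) (hδX : 0 < δX)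
    {V : Set (ℂ × ℂ)} (hV : IsOpen V) (hKV : closedBall (0 : ℂ × ℂ) δX ⊆ V)
    (hX : ContDiffOn ℝ 1 X V) (hu1 : ContDiffOn ℝ 1 uh (ball 0 ρ₁))
    (hu0 : ∀ w ∈ ball (0 : ℂ) ρ₁, ‖uh w‖ ≤ Cu * ‖w‖ ^ (k + 1))
    (hDu : ∀ w ∈ ball (0 : ℂ) ρ₁, ‖fderiv ℝ uh w‖ ≤ Cu * ‖w‖ ^ k)
    (hX1 : ∀ x ∈ closedBall (0 : ℂ × ℂ) δX, ∀ w, ‖X x w - (0, w)‖ ≤ CX * ‖x.2‖ * ‖w‖)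
    (hX2 : ∀ x ∈ closedBall (0 : ℂ × ℂ) δX, ∀ x' ∈ closedBall (0 : ℂ × ℂ) δX, ∀ w,
      ‖X x w - X x' w‖ ≤ CX * ‖x - x'‖ * ‖w‖) :
    ∃ ε₂ B : ℝ, 0 < ε₂ ∧ 0 ≤ B ∧ ∀ s : ℂ, s ≠ 0 → ‖s‖ < ε₂ →
      DifferentiableAt ℝ (sol k εb uh X (2 * Cu + 1)) s ∧
      ‖fderiv ℝ (sol k εb uh X (2 * Cu + 1)) s‖ ≤ B ∧
      ‖fderiv ℝ (fun s' => (sol k εb uh X (2 * Cu + 1) s').1) s‖ ≤ B ∧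
      ‖fderiv ℝ (fun s' => (sol k εb uh X (2 * Cu + 1) s').2) s‖ ≤ B := by
  set b : ℝ := 2 * Cu + 1 with hb
  obtain ⟨ε₁, hε₁, hreg⟩ :=
    exists_regular_branch hk hε hεn hCu hCX hρ₁ hδX hV hKV hX hu1 hu0 hDu hX1 hX2
  obtain ⟨L, δ, hL, hδ, hδ1, hLip1, hDer⟩ := exists_kthRoot_lipschitz k
  -- ### the extra smallness making `|X̌| < δ |s|ᵏ`
  set K₄ : ℝ := CX * Cu * 2 ^ (k + 1) * b with hK₄
  have hK₄0 : 0 ≤ K₄ := by positivity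
  set ε₃ : ℝ := min 1 (δ / (K₄ + 1)) with hε₃
  have hε₃pos : 0 < ε₃ := lt_min one_pos (by positivity)
  set ε₂ : ℝ := min ε₁ ε₃ with hε₂
  set B : ℝ := 2 * (1 + L + L * k + Cu) with hB
  have hB0 : 0 ≤ B := by positivity
  refine ⟨ε₂, B, lt_min hε₁ hε₃pos, hB0, fun s hs hsε => ?_⟩
  have hsε₁ : ‖s‖ < ε₁ := hsε.trans_le (min_le_left _ _)
  have hs1 : ‖s‖ ≤ 1 := (hsε.trans_le ((min_le_right _ _).trans (min_le_left _ _))).le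
  have hsδ : ‖s‖ < δ / (K₄ + 1) :=
    hsε.trans_le ((min_le_right _ _).trans (min_le_right _ _))
  obtain ⟨hr1, hrρ, hrδ1, hrδ2, hvbox, hfix, hin1, hin2, heqs, hcontr, hnhds, ha', hsolC1⟩ :=
    hreg s hs hsε₁
  set v := sol k εb uh X b s with hv
  have hr0 : 0 < ‖s‖ := norm_pos_iff.2 hs
  have hsρ : s ∈ ball (0 : ℂ) ρ₁ := by rw [mem_ball, dist_zero_right]; linarith
  -- `|X̌_{η}(p θ)| < δ |s|ᵏ`
  obtain ⟨-, -, hvρ, -, hpmem, haX, -⟩ :=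
    box_pointwise hCu hCX hu0 hX1 hεn hr1 hrρ hrδ1 hrδ2 hvbox
  have haδ : ‖(X (pt k uh v.1) v.2).1‖ < δ * ‖s‖ ^ k := by
    have h1 : CX * (Cu * (2 * ‖s‖) ^ (k + 1)) * (b * ‖s‖ ^ (k + 1)) =
        K₄ * ‖s‖ ^ (k + 2) * ‖s‖ ^ k := by rw [hK₄]; ring
    have h2 : K₄ * ‖s‖ ^ (k + 2) < δ := by
      have h3 : ‖s‖ ^ (k + 2) ≤ ‖s‖ := by
        calc ‖s‖ ^ (k + 2) ≤ ‖s‖ ^ 1 := pow_le_pow_of_le_one hr0.le hs1 (by omega)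
          _ = ‖s‖ := pow_one _
      have h4 : K₄ * ‖s‖ < δ := by
        have h5 : K₄ * ‖s‖ ≤ K₄ * (δ / (K₄ + 1)) := by gcongr
        have h6 : K₄ * (δ / (K₄ + 1)) < δ := by
          rw [mul_div_assoc']
          rw [div_lt_iff₀ (by positivity)]
          nlinarith
        linarith
      calc K₄ * ‖s‖ ^ (k + 2) ≤ K₄ * ‖s‖ := by gcongr
        _ < δ := h4
    calc ‖(X (pt k uh v.1) v.2).1‖ ≤ CX * (Cu * (2 * ‖s‖) ^ (k + 1)) * (b * ‖s‖ ^ (k + 1)) := haX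
      _ = K₄ * ‖s‖ ^ (k + 2) * ‖s‖ ^ k := h1
      _ < δ * ‖s‖ ^ k := by gcongr
  -- ### the comparison
  have hreg' : ∀ s : ℂ, s ≠ 0 → ‖s‖ < ε₁ →
      sol k εb uh X (2 * Cu + 1) s ∈ box k εb (2 * Cu + 1) s ∧
      Tmap k εb uh X s (sol k εb uh X (2 * Cu + 1) s) = sol k εb uh X (2 * Cu + 1) s ∧
      ‖(sol k εb uh X (2 * Cu + 1) s).1 - εb * s‖ ≤ ‖s‖ ^ (k + 2) / 2 ∧
      ‖(sol k εb uh X (2 * Cu + 1) s).2‖ ≤ (2 * Cu + 1 / 2) * ‖s‖ ^ (k + 1) ∧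
      (∀ v ∈ box k εb (2 * Cu + 1) s, ∀ v' ∈ box k εb (2 * Cu + 1) s,
        dist (Tmap k εb uh X s v) (Tmap k εb uh X s v') ≤ dist v v' / 2) := by
    intro s hs hsε
    obtain ⟨-, -, -, -, h1, h2, h3, h4, -, h5, -⟩ := hreg s hs hsε
    exact ⟨h1, h2, h3, h4, h5⟩
  have hev := eventually_norm_sol_sub_le (k := k) (X := X) (uh := uh) hεn hreg' hs hsε₁
  obtain ⟨hTd, hTn⟩ := norm_fderiv_Tmap_left_le (εb := εb) (X := X) (v := v) hk hL hδ1 hLip1 hDer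
    hεn hCu hu1 hDu hs hs1 hsρ haδ
  have hsold : DifferentiableAt ℝ (sol k εb uh X b) s := hsolC1.differentiableAt one_ne_zero
  have hmain : ‖fderiv ℝ (sol k εb uh X b) s‖ ≤ B := by
    have h := norm_fderiv_le_of_eventually_norm_sub_le (by norm_num : (0 : ℝ) ≤ 2) hsold hTd hev
    calc ‖fderiv ℝ (sol k εb uh X b) s‖
        ≤ 2 * ‖fderiv ℝ (fun s' : ℂ => Tmap k εb uh X s' v) s‖ := h
      _ ≤ 2 * (1 + L + L * k + Cu) := by gcongr
      _ = B := by rw [hB]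
  -- ### the components
  have hfst : ‖fderiv ℝ (fun s' => (sol k εb uh X b s').1) s‖ ≤ B := by
    have h1 : fderiv ℝ (fun s' => (sol k εb uh X b s').1) s =
        (ContinuousLinearMap.fst ℝ ℂ ℂ).comp (fderiv ℝ (sol k εb uh X b) s) :=
      (hsold.hasFDerivAt.fst).fderiv
    rw [h1]
    calc ‖(ContinuousLinearMap.fst ℝ ℂ ℂ).comp (fderiv ℝ (sol k εb uh X b) s)‖
        ≤ ‖ContinuousLinearMap.fst ℝ ℂ ℂ‖ * ‖fderiv ℝ (sol k εb uh X b) s‖ :=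
          ContinuousLinearMap.opNorm_comp_le _ _
      _ ≤ 1 * B := by
          gcongr
          exact ContinuousLinearMap.norm_fst_le ℝ ℂ ℂ
      _ = B := one_mul B
  have hsnd : ‖fderiv ℝ (fun s' => (sol k εb uh X b s').2) s‖ ≤ B := by
    have h1 : fderiv ℝ (fun s' => (sol k εb uh X b s').2) s =
        (ContinuousLinearMap.snd ℝ ℂ ℂ).comp (fderiv ℝ (sol k εb uh X b) s) :=
      (hsold.hasFDerivAt.snd).fderiv
    rw [h1]
    calc ‖(ContinuousLinearMap.snd ℝ ℂ ℂ).comp (fderiv ℝ (sol k εb uh X b) s)‖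
        ≤ ‖ContinuousLinearMap.snd ℝ ℂ ℂ‖ * ‖fderiv ℝ (sol k εb uh X b) s‖ :=
          ContinuousLinearMap.opNorm_comp_le _ _
      _ ≤ 1 * B := by
          gcongr
          exact ContinuousLinearMap.norm_snd_le ℝ ℂ ℂ
      _ = B := one_mul B
  exact ⟨hsold, hmain, hfst, hsnd⟩

end Literature.Geometry.Symplectic.RotationBranch

end
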